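import Mathlib
import HarnessLib
import Literature.NumberTheory.LFunctions.RiemannHypothesisUpTo1000X
import Literature.NumberTheory.LFunctions.ZetaZeroFreeRegion
import Literature.NumberTheory.LFunctions.ZetaRealAxis
import Literature.NumberTheory.LFunctions.GeneralizedRH
import Literature.NumberTheory.LFunctions.HardyZExtremaCriterion
import Literature.NumberTheory.LFunctions.DeuringZeroSpacingPhenomenon
import Literature.NumberTheory.LFunctions.ZetaZeros
import Literature.NumberTheory.LFunctions.ZeroCounting
import Literature.NumberTheory.LFunctions.ExplicitZeroFreeRegionRoundsProofs
import Literature.NumberTheory.DiophantineGeometry.NamedHypotheses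
import Literature.NumberTheory.LFunctions.DeBruijnNewmanConstProofs
import Literature.NumberTheory.LFunctions.RiemannXiProofs
import Literature.Analysis.Complex.LaguerrePolyaClass
import Literature.NumberTheory.LFunctions.XiLaguerreSeparationRH
import Mathlib.Analysis.Calculus.DerivativeTest
import Mathlib.Analysis.Complex.RealDeriv
import Summits.RiemannHypothesis.RiemannHypothesis.Theorems.Splittings.EarlyAppointmentsLocalFourierPolya
import Literature.Analysis.Complex.JensenCircles
import Mathlib.Analysis.Real.Pi.Bounds
import Mathlib.Analysis.SpecialFunctions.Trigonometric.Complex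
import Literature.NumberTheory.DiophantineGeometry.NamedHypothesesRHProofs

/-! # TiltedLandingLaw421 — descent seam, part 01
Token-identical port of the descent framework of `Cruxes/TiltedLandingLaw421/Lines/law421birthS.lean`
(seam canon ce03e18b) into flat Theorems modules, so that crux line files can import it instead of inlining it.
No new mathematics; no `sorry`; no route (Theses) imports — the tree statement is mirrored as `RhW07.Seam.Law421Statement`. -/

namespace RhW07.Seam
/-- The statement of `TiltedLandingLaw421`, copied token-identically from `Theses/EarlyAppointments.lean` (seam-local name; a line file that imports the Theses bridges by definitional unfolding). -/
def Law421Statement : Prop :=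
  ∀ (η : ℝ) (f : ℂ → ℂ) (x₀ s hmax R Hs : ℝ) (B : ℕ), Differentiable ℂ f → (∀ x : ℝ, (f (x : ℂ)).im = 0) → (∃ A' B' ρ : ℝ, ρ < 2 ∧ ∀ z : ℂ, ‖f z‖ ≤ A' * Real.exp (B' * ‖z‖ ^ ρ)) → 0 < s → 2 * s ≤ hmax → 2 * hmax ≤ R → 3 * hmax < R → 0 ≤ Hs → (∀ w : ℂ, f w = 0 → |w.im| ≤ Hs) → 2 * Hs ≤ R → (∃ w₀ : ℂ, f w₀ = 0 ∧ w₀.im ≠ 0 ∧ w₀.re = x₀ ∧ |w₀.im| ≤ hmax) → (∀ r : ℝ, s ≤ r → r ≤ R → (∑ᶠ u ∈ {u : ℂ | f u = 0 ∧ |u.re - x₀| ≤ r}, ((analyticOrderAt f u).toNat : ℝ)) - 2 * r / s ≤ B) → (∀ r : ℝ, s ≤ r → r ≤ R → |(∑ᶠ u ∈ {u : ℂ | f u = 0 ∧ x₀ < u.re ∧ u.re ≤ x₀ + r}, ((analyticOrderAt f u).toNat : ℝ)) - r / s| ≤ 1 + B ∧ |(∑ᶠ u ∈ {u : ℂ |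 f u = 0 ∧ x₀ - r ≤ u.re ∧ u.re < x₀}, ((analyticOrderAt f u).toNat : ℝ)) - r / s| ≤ 1 + B) → 0 ≤ η → 2 * η ≤ 1 → (∀ w : ℂ, |w.re - x₀| ≤ R / 2 → |w.im| ≤ hmax → f w ≠ 0 → ‖deriv f w / f w - ∑ᶠ u ∈ {u : ℂ | f u = 0 ∧ |u.re - w.re| < R / 2}, ((analyticOrderAt f u).toNat : ℂ) * (w - u)⁻¹‖ ≤ η / s) → ∃ k : ℕ, (k : ℝ) ≤ 4 * hmax / s + (Hs / s) ^ 2 + B + 1 ∧ ∃ x : ℝ, |x - x₀| < ((k : ℝ) + 3) * R / 2 ∧ ((iteratedDeriv (k + 1) f (x : ℂ)).re = 0 ∧ (iteratedDeriv k f (x : ℂ)).re ≠ 0 ∧ 0 ≤ (iteratedDeriv k f (x : ℂ)).re * (iteratedDeriv (k + 2) f (x : ℂ)).re)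
end RhW07.Seam


/-! K SEAM of the c12 FieldSplit node = lines 1–4275 of the comment-stripped image cdb76f90b852804b of C4 reg/fieldsplit_v1.lean b3a506aa9fa0ce6f (seam 899418f2, node rev c e5335abe); diagnostics blanked; fully proved. (CA224) R7 step 1; imported by future Lines files. RH is not proved. -/
noncomputable section
open Complex
namespace RhIdea6.G17.W07C7
open Literature.NumberTheory.LFunctions Literature.NumberTheory.DiophantineGeometry
open Summit.RiemannHypothesis.RiemannHypothesis.Theses
/-- `OffLineZeroAt` — seam of the TiltedLandingLaw421 descent framework, part 01 (token-identical port of `Cruxes/TiltedLandingLaw421/Lines/law421birthS.lean`; no new mathematics). -/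
def OffLineZeroAt (γ δ : ℝ) : Prop :=
  riemannZeta ⟨1 / 2 + δ, γ⟩ = 0 ∧ 0 < δ

/-- `SeenClean` — seam of the TiltedLandingLaw421 descent framework, part 01 (token-identical port of `Cruxes/TiltedLandingLaw421/Lines/law421birthS.lean`; no new mathematics). -/
def SeenClean (S : Set (ℝ × ℝ)) : Prop :=
  ∀ γ' δ' : ℝ, (γ', δ') ∈ S → ¬ OffLineZeroAt γ' δ'

/-- `seenHeight` — seam of the TiltedLandingLaw421 descent framework, part 01 (token-identical port of `Cruxes/TiltedLandingLaw421/Lines/law421birthS.lean`; no new mathematics). -/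
def seenHeight (T₀ : ℝ) : Set (ℝ × ℝ) := {p | 0 < p.1 ∧ p.1 ≤ T₀}

/-- `seenClean_height_of_upTo` — seam of the TiltedLandingLaw421 descent framework, part 01 (token-identical port of `Cruxes/TiltedLandingLaw421/Lines/law421birthS.lean`; no new mathematics). -/
theorem seenClean_height_of_upTo {T₀ : ℝ} (h : RiemannHypothesisUpTo T₀) :
    SeenClean (seenHeight T₀) := by
  intro γ' δ' hS hz
  obtain ⟨hγ0, hγT⟩ := hS
  obtain ⟨hzero, hδ⟩ := hz
  have hre := h ⟨1 / 2 + δ', γ'⟩ hzero (by simpa using hγ0) (by simpa using hγT)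
  simp at hre
  linarith

/-- `seenOneLine` — seam of the TiltedLandingLaw421 descent framework, part 01 (token-identical port of `Cruxes/TiltedLandingLaw421/Lines/law421birthS.lean`; no new mathematics). -/
def seenOneLine : Set (ℝ × ℝ) := {p | 1 / 2 ≤ p.2}

/-- `seenClean_oneLine` — seam of the TiltedLandingLaw421 descent framework, part 01 (token-identical port of `Cruxes/TiltedLandingLaw421/Lines/law421birthS.lean`; no new mathematics). -/
theorem seenClean_oneLine : SeenClean seenOneLine := by
  intro γ' δ' hS hz
  obtain ⟨hzero, _⟩ := hz
  have h1 : (1 : ℝ) ≤ (⟨1 / 2 + δ', γ'⟩ : ℂ).re := by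
    show (1 : ℝ) ≤ 1 / 2 + δ'
    have : 1 / 2 ≤ δ' := hS
    linarith
  exact riemannZeta_ne_zero_of_one_le_re h1 hzero

/-- `OffLineZeroAt.lt_half` — seam of the TiltedLandingLaw421 descent framework, part 01 (token-identical port of `Cruxes/TiltedLandingLaw421/Lines/law421birthS.lean`; no new mathematics). -/
theorem OffLineZeroAt.lt_half {γ δ : ℝ} (h : OffLineZeroAt γ δ) : δ < 1 / 2 := by
  by_contra hge
  exact seenClean_oneLine γ δ (show 1 / 2 ≤ δ from not_lt.1 hge) h

/-- `allClean_of_height` — seam of the TiltedLandingLaw421 descent framework, part 01 (token-identical port of `Cruxes/TiltedLandingLaw421/Lines/law421birthS.lean`; no new mathematics). -/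
theorem allClean_of_height {T₀ : ℝ} (hH : RiemannHypothesisUpTo T₀) (h : SeenClean {p | T₀ < p.1}) :
    SeenClean {p | 0 < p.1} := by
  intro γ δ hγ hz
  rcases le_or_gt γ T₀ with hle | hgt
  · exact seenClean_height_of_upTo hH γ δ ⟨hγ, hle⟩ hz
  · exact h γ δ hgt hz

/-- `rh_of_allClean` — seam of the TiltedLandingLaw421 descent framework, part 01 (token-identical port of `Cruxes/TiltedLandingLaw421/Lines/law421birthS.lean`; no new mathematics). -/
theorem rh_of_allClean (h : SeenClean {p | 0 < p.1}) : RiemannHypothesis := by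
  refine riemannHypothesis_iff_strip_holds.2 fun s hs h0 h1 ↦ ?_

  have key : ∀ s : ℂ, riemannZeta s = 0 → 0 < s.re → s.re < 1 → 0 < s.im → s.re = 1 / 2 := by
    intro s hs h0 h1 him
    by_contra hne
    rcases lt_or_gt_of_ne hne with hlt | hgt
    ·
      have hz : riemannZeta ⟨1 / 2 + (1 / 2 - s.re), s.im⟩ = 0 := by
        have h' := Literature.NumberTheory.DiophantineGeometry.riemannZeta_conj_eq_zero (Literature.NumberTheory.LFunctions.GeneralizedRH.riemannZeta_one_sub_eq_zero hs h0 h1)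
        have e : starRingEnd ℂ (1 - s) = ⟨1 / 2 + (1 / 2 - s.re), s.im⟩ := by
          apply Complex.ext
          · simp; ring
          · simp
        rwa [e] at h'
      exact h s.im (1 / 2 - s.re) him ⟨hz, by linarith⟩
    · have hz : riemannZeta ⟨1 / 2 + (s.re - 1 / 2), s.im⟩ = 0 := by
        have e : (⟨1 / 2 + (s.re - 1 / 2), s.im⟩ : ℂ) = s := by
          apply Complex.ext <;> simp
        rw [e]; exact hs
      exact h s.im (s.re - 1 / 2) him ⟨hz, by linarith⟩
  have him : s.im ≠ 0 := im_ne_zero_of_riemannZeta_eq_zero hs h0 h1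
  rcases lt_or_gt_of_ne him with hneg | hpos
  · have := key (starRingEnd ℂ s) (Literature.NumberTheory.DiophantineGeometry.riemannZeta_conj_eq_zero hs) (by simpa using h0) (by simpa using h1)
      (by simpa using hneg)
    simpa using this
  · exact key s hs h0 h1 hpos

/-- `seenClean_of_rh` — seam of the TiltedLandingLaw421 descent framework, part 01 (token-identical port of `Cruxes/TiltedLandingLaw421/Lines/law421birthS.lean`; no new mathematics). -/
theorem seenClean_of_rh (hRH : RiemannHypothesis) (S : Set (ℝ × ℝ)) : SeenClean S := by
  intro γ δ _ hz
  have hlt : δ < 1 / 2 := hz.lt_half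
  obtain ⟨hzero, hδ⟩ := hz
  have htriv : ¬∃ n : ℕ, (⟨1 / 2 + δ, γ⟩ : ℂ) = -2 * (n + 1) := by
    rintro ⟨n, hn⟩
    have := congrArg Complex.re hn
    simp at this
    have : (0 : ℝ) ≤ n := Nat.cast_nonneg n
    linarith
  have hne : (⟨1 / 2 + δ, γ⟩ : ℂ) ≠ 1 := by
    intro h1
    have := congrArg Complex.re h1
    simp at this
    linarith
  have := hRH _ hzero htriv hne
  simp at this
  linarith

namespace C3
/-- `verifiedHeight` — seam of the TiltedLandingLaw421 descent framework, part 01 (token-identical port of `Cruxes/TiltedLandingLaw421/Lines/law421birthS.lean`; no new mathematics). -/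
def verifiedHeight : ℝ := 3000175332800

end C3
/-- `upTo_of_PT` — seam of the TiltedLandingLaw421 descent framework, part 01 (token-identical port of `Cruxes/TiltedLandingLaw421/Lines/law421birthS.lean`; no new mathematics). -/
theorem upTo_of_PT (h : platt_trudgian_numerical_rh) : RiemannHypothesisUpTo C3.verifiedHeight :=
  fun s hs h0 hT ↦ h s hs h0 hT

/-- `xiDerivLine` — seam of the TiltedLandingLaw421 descent framework, part 01 (token-identical port of `Cruxes/TiltedLandingLaw421/Lines/law421birthS.lean`; no new mathematics). -/
def xiDerivLine (m : ℕ) (t : ℝ) : ℝ := (iteratedDeriv m riemannXiUpper (t : ℂ)).re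

/-- `WindowedLaguerreToDepth` — seam of the TiltedLandingLaw421 descent framework, part 01 (token-identical port of `Cruxes/TiltedLandingLaw421/Lines/law421birthS.lean`; no new mathematics). -/
def WindowedLaguerreToDepth (E : ℕ → ℝ → Prop) (K : ℝ → ℕ) (T₀ : ℝ) : Prop :=
  ∀ t : ℝ, T₀ < t → ∀ m : ℕ, m ≤ K t → ¬ E m t

/-- `LandingLawToDepth` — seam of the TiltedLandingLaw421 descent framework, part 01 (token-identical port of `Cruxes/TiltedLandingLaw421/Lines/law421birthS.lean`; no new mathematics). -/
def LandingLawToDepth (E : ℕ → ℝ → Prop) (K : ℝ → ℕ) (T₀ T₁ : ℝ) : Prop :=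
  ∀ γ δ : ℝ, T₁ < γ → OffLineZeroAt γ δ → ∃ t : ℝ, T₀ < t ∧ ∃ m : ℕ, m ≤ K t ∧ E m t

/-- `rh_of_ladderSplit` — seam of the TiltedLandingLaw421 descent framework, part 01 (token-identical port of `Cruxes/TiltedLandingLaw421/Lines/law421birthS.lean`; no new mathematics). -/
theorem rh_of_ladderSplit {E : ℕ → ℝ → Prop} {K : ℝ → ℕ} {T₀ T₁ T' : ℝ}
    (hH : RiemannHypothesisUpTo T') (hT₁ : T₁ ≤ T')
    (hS : WindowedLaguerreToDepth E K T₀) (hD : LandingLawToDepth E K T₀ T₁) : RiemannHypothesis := by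
  refine rh_of_allClean (allClean_of_height hH ?_)
  intro γ δ hTγ hz
  have hTγ' : T' < γ := hTγ
  obtain ⟨t, ht, m, hm, hE⟩ := hD γ δ (lt_of_le_of_lt hT₁ hTγ') hz
  exact hS t ht m hm hE

/-- `xiNLEvent` — seam of the TiltedLandingLaw421 descent framework, part 01 (token-identical port of `Cruxes/TiltedLandingLaw421/Lines/law421birthS.lean`; no new mathematics). -/
def xiNLEvent (k : ℕ) (x : ℝ) : Prop :=
  xiDerivLine (k + 1) x = 0 ∧ xiDerivLine k x ≠ 0 ∧ 0 ≤ xiDerivLine k x * xiDerivLine (k + 2) x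

/-- `LandingLawOnBand` — seam of the TiltedLandingLaw421 descent framework, part 01 (token-identical port of `Cruxes/TiltedLandingLaw421/Lines/law421birthS.lean`; no new mathematics). -/
def LandingLawOnBand (E : ℕ → ℝ → Prop) (K : ℝ → ℕ) (T₀ T₁ : ℝ) (P : ℝ → ℝ → Prop) : Prop :=
  ∀ γ δ : ℝ, T₁ < γ → OffLineZeroAt γ δ → P γ δ → ∃ t : ℝ, T₀ < t ∧ ∃ m : ℕ, m ≤ K t ∧ E m t

/-- `LandingLawOnBand.mono_event` — seam of the TiltedLandingLaw421 descent framework, part 01 (token-identical port of `Cruxes/TiltedLandingLaw421/Lines/law421birthS.lean`; no new mathematics). -/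
theorem LandingLawOnBand.mono_event {E E' : ℕ → ℝ → Prop} {K : ℝ → ℕ} {T₀ T₁ : ℝ} {P : ℝ → ℝ → Prop}
    (hEE : ∀ m t, E m t → E' m t) (h : LandingLawOnBand E K T₀ T₁ P) : LandingLawOnBand E' K T₀ T₁ P := by
  intro γ δ hγ hz hP
  obtain ⟨t, ht, m, hm, hE⟩ := h γ δ hγ hz hP
  exact ⟨t, ht, m, hm, hEE m t hE⟩

/-- `thinBandL` — seam of the TiltedLandingLaw421 descent framework, part 01 (token-identical port of `Cruxes/TiltedLandingLaw421/Lines/law421birthS.lean`; no new mathematics). -/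
def thinBandL (a : ℝ → ℝ) (γ δ : ℝ) : Prop := δ ≤ a γ

/-- `middleBandL` — seam of the TiltedLandingLaw421 descent framework, part 01 (token-identical port of `Cruxes/TiltedLandingLaw421/Lines/law421birthS.lean`; no new mathematics). -/
def middleBandL (a b : ℝ → ℝ) (γ δ : ℝ) : Prop := a γ < δ ∧ δ < b γ

/-- `thickBandL` — seam of the TiltedLandingLaw421 descent framework, part 01 (token-identical port of `Cruxes/TiltedLandingLaw421/Lines/law421birthS.lean`; no new mathematics). -/
def thickBandL (b : ℝ → ℝ) (γ δ : ℝ) : Prop := b γ ≤ δ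

/-- `thinEdge` — seam of the TiltedLandingLaw421 descent framework, part 01 (token-identical port of `Cruxes/TiltedLandingLaw421/Lines/law421birthS.lean`; no new mathematics). -/
def thinEdge (cthin : ℝ) (γ : ℝ) : ℝ := cthin / Real.log γ ^ 2

/-- `thickEdge` — seam of the TiltedLandingLaw421 descent framework, part 01 (token-identical port of `Cruxes/TiltedLandingLaw421/Lines/law421birthS.lean`; no new mathematics). -/
def thickEdge (Cthick : ℝ) (γ : ℝ) : ℝ := Cthick * (2 * Real.pi / Real.log (γ / (2 * Real.pi)))

/-- `lowBandL` — seam of the TiltedLandingLaw421 descent framework, part 01 (token-identical port of `Cruxes/TiltedLandingLaw421/Lines/law421birthS.lean`; no new mathematics). -/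
def lowBandL (a l : ℝ → ℝ) (γ δ : ℝ) : Prop := a γ < δ ∧ δ ≤ l γ

/-- `seamBandL` — seam of the TiltedLandingLaw421 descent framework, part 01 (token-identical port of `Cruxes/TiltedLandingLaw421/Lines/law421birthS.lean`; no new mathematics). -/
def seamBandL (l b : ℝ → ℝ) (γ δ : ℝ) : Prop := l γ < δ ∧ δ < b γ

/-- `bands4_cover` — seam of the TiltedLandingLaw421 descent framework, part 01 (token-identical port of `Cruxes/TiltedLandingLaw421/Lines/law421birthS.lean`; no new mathematics). -/
theorem bands4_cover (a l b : ℝ → ℝ) (γ δ : ℝ) :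
    thinBandL a γ δ ∨ lowBandL a l γ δ ∨ seamBandL l b γ δ ∨ thickBandL b γ δ := by
  unfold thinBandL lowBandL seamBandL thickBandL
  rcases le_or_gt δ (a γ) with h | h
  · exact Or.inl h
  · rcases le_or_gt δ (l γ) with h' | h'
    · exact Or.inr (Or.inl ⟨h, h'⟩)
    · rcases lt_or_ge δ (b γ) with h'' | h''
      · exact Or.inr (Or.inr (Or.inl ⟨h', h''⟩))
      · exact Or.inr (Or.inr (Or.inr h''))

/-- `landingLawOnBand_of_empty` — seam of the TiltedLandingLaw421 descent framework, part 01 (token-identical port of `Cruxes/TiltedLandingLaw421/Lines/law421birthS.lean`; no new mathematics). -/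
theorem landingLawOnBand_of_empty {E : ℕ → ℝ → Prop} {K : ℝ → ℕ} {T₀ T₁ : ℝ} {P : ℝ → ℝ → Prop}
    (h : ∀ γ δ : ℝ, T₁ < γ → OffLineZeroAt γ δ → ¬ P γ δ) : LandingLawOnBand E K T₀ T₁ P :=
  fun γ δ hγ hz hP ↦ absurd hP (h γ δ hγ hz)

/-- `rh_of_bandJoin4` — seam of the TiltedLandingLaw421 descent framework, part 01 (token-identical port of `Cruxes/TiltedLandingLaw421/Lines/law421birthS.lean`; no new mathematics). -/
theorem rh_of_bandJoin4 {E E₁ E₂ E₃ E₄ : ℕ → ℝ → Prop} {K : ℝ → ℕ} {T₀ T₁ T' : ℝ} {a l b : ℝ → ℝ}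
    (hH : RiemannHypothesisUpTo T') (hT₁ : T₁ ≤ T') (hS : WindowedLaguerreToDepth E K T₀)
    (h₁ : LandingLawOnBand E₁ K T₀ T₁ (thinBandL a)) (h₂ : LandingLawOnBand E₂ K T₀ T₁ (lowBandL a l))
    (h₃ : LandingLawOnBand E₃ K T₀ T₁ (seamBandL l b)) (h₄ : LandingLawOnBand E₄ K T₀ T₁ (thickBandL b))
    (hE₁ : ∀ m t, E₁ m t → E m t) (hE₂ : ∀ m t, E₂ m t → E m t) (hE₃ : ∀ m t, E₃ m t → E m t)
    (hE₄ : ∀ m t, E₄ m t → E m t) : RiemannHypothesis := by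
  refine rh_of_ladderSplit hH hT₁ hS fun γ δ hγ hz ↦ ?_
  rcases bands4_cover a l b γ δ with hP | hP | hP | hP
  · exact (h₁.mono_event hE₁) γ δ hγ hz hP
  · exact (h₂.mono_event hE₂) γ δ hγ hz hP
  · exact (h₃.mono_event hE₃) γ δ hγ hz hP
  · exact (h₄.mono_event hE₄) γ δ hγ hz hP

/-- `SeamClosed` — seam of the TiltedLandingLaw421 descent framework, part 01 (token-identical port of `Cruxes/TiltedLandingLaw421/Lines/law421birthS.lean`; no new mathematics). -/
def SeamClosed (c C T₁ : ℝ) : Prop := ∀ γ : ℝ, T₁ < γ → thickEdge C γ ≤ thickEdge c γ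

/-- `seamClosed_of_le` — seam of the TiltedLandingLaw421 descent framework, part 01 (token-identical port of `Cruxes/TiltedLandingLaw421/Lines/law421birthS.lean`; no new mathematics). -/
theorem seamClosed_of_le {c C T₁ : ℝ} (hcC : C ≤ c) (hT₁ : 2 * Real.pi ≤ T₁) : SeamClosed c C T₁ := by
  intro γ hγ
  unfold thickEdge
  have h2pi : 0 < 2 * Real.pi := by positivity
  have hlog : 0 < Real.log (γ / (2 * Real.pi)) :=
    Real.log_pos ((one_lt_div h2pi).2 (lt_of_le_of_lt hT₁ hγ))
  exact mul_le_mul_of_nonneg_right hcC (div_nonneg h2pi.le hlog.le)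

/-- `seam_empty_of_closed` — seam of the TiltedLandingLaw421 descent framework, part 01 (token-identical port of `Cruxes/TiltedLandingLaw421/Lines/law421birthS.lean`; no new mathematics). -/
theorem seam_empty_of_closed {c C T₁ : ℝ} (h : SeamClosed c C T₁) (γ δ : ℝ) (hγ : T₁ < γ) :
    ¬ seamBandL (thickEdge c) (thickEdge C) γ δ := by
  rintro ⟨h1, h2⟩
  exact absurd (h1.trans h2) (not_lt.2 (h γ hγ))

/-- `xiNLEventLow` — seam of the TiltedLandingLaw421 descent framework, part 01 (token-identical port of `Cruxes/TiltedLandingLaw421/Lines/law421birthS.lean`; no new mathematics). -/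
def xiNLEventLow (m : ℕ) (x : ℝ) : Prop := m ≤ 1 ∧ xiNLEvent m x

/-- `NLEventOf` — seam of the TiltedLandingLaw421 descent framework, part 01 (token-identical port of `Cruxes/TiltedLandingLaw421/Lines/law421birthS.lean`; no new mathematics). -/
def NLEventOf (f : ℂ → ℂ) (k : ℕ) (x : ℝ) : Prop :=
  (iteratedDeriv (k + 1) f (x : ℂ)).re = 0 ∧ (iteratedDeriv k f (x : ℂ)).re ≠ 0 ∧
    0 ≤ (iteratedDeriv k f (x : ℂ)).re * (iteratedDeriv (k + 2) f (x : ℂ)).re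

/-- `nlEventOf_xi_iff` — seam of the TiltedLandingLaw421 descent framework, part 01 (token-identical port of `Cruxes/TiltedLandingLaw421/Lines/law421birthS.lean`; no new mathematics). -/
theorem nlEventOf_xi_iff (k : ℕ) (x : ℝ) : NLEventOf riemannXiUpper k x ↔ xiNLEvent k x := Iff.rfl

/-- `EventConcl` — seam of the TiltedLandingLaw421 descent framework, part 01 (token-identical port of `Cruxes/TiltedLandingLaw421/Lines/law421birthS.lean`; no new mathematics). -/
def EventConcl (C : ℝ) (f : ℂ → ℂ) (x₀ s hmax R : ℝ) (B : ℕ) : Prop :=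
  ∃ k : ℕ, (k : ℝ) ≤ C * hmax / s + B + 1 ∧ ∃ x : ℝ, |x - x₀| < R / 2 + Real.sqrt k * hmax ∧ NLEventOf f k x

/-- `RemainderBox` — seam of the TiltedLandingLaw421 descent framework, part 01 (token-identical port of `Cruxes/TiltedLandingLaw421/Lines/law421birthS.lean`; no new mathematics). -/
def RemainderBox (η : ℝ) (f : ℂ → ℂ) (x₀ s hmax R : ℝ) : Prop :=
  ∀ w : ℂ, |w.re - x₀| ≤ R / 2 → |w.im| ≤ hmax → f w ≠ 0 →
    ‖deriv f w / f w
        - ∑ᶠ u ∈ {u : ℂ | f u = 0 ∧ |u.re - w.re| < R / 2}, ((analyticOrderAt f u).toNat : ℂ) * (w - u)⁻¹‖ ≤ η / s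

/-- `ColumnBudgetMult` — seam of the TiltedLandingLaw421 descent framework, part 01 (token-identical port of `Cruxes/TiltedLandingLaw421/Lines/law421birthS.lean`; no new mathematics). -/
def ColumnBudgetMult (B : ℕ) (f : ℂ → ℂ) (x₀ s R : ℝ) : Prop :=
  ∀ r : ℝ, s ≤ r → r ≤ R →
    (∑ᶠ u ∈ {u : ℂ | f u = 0 ∧ |u.re - x₀| ≤ r}, ((analyticOrderAt f u).toNat : ℝ)) - 2 * r / s ≤ B

/-- `HalfSlabBudget` — seam of the TiltedLandingLaw421 descent framework, part 01 (token-identical port of `Cruxes/TiltedLandingLaw421/Lines/law421birthS.lean`; no new mathematics). -/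
def HalfSlabBudget (B : ℕ) (f : ℂ → ℂ) (x₀ s R : ℝ) : Prop :=
  ∀ r : ℝ, s ≤ r → r ≤ R →
    |(∑ᶠ u ∈ {u : ℂ | f u = 0 ∧ x₀ < u.re ∧ u.re ≤ x₀ + r}, ((analyticOrderAt f u).toNat : ℝ)) - r / s| ≤ 1 + B ∧
    |(∑ᶠ u ∈ {u : ℂ | f u = 0 ∧ x₀ - r ≤ u.re ∧ u.re < x₀}, ((analyticOrderAt f u).toNat : ℝ)) - r / s| ≤ 1 + B

/-- `TiltedLandingEventAt3` — seam of the TiltedLandingLaw421 descent framework, part 01 (token-identical port of `Cruxes/TiltedLandingLaw421/Lines/law421birthS.lean`; no new mathematics). -/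
def TiltedLandingEventAt3 (A C η : ℝ) (f : ℂ → ℂ) (x₀ s hmax R Hs : ℝ) (B : ℕ) : Prop :=
  Differentiable ℂ f → (∀ x : ℝ, (f (x : ℂ)).im = 0) →
    (∃ A' B' ρ : ℝ, ρ < 2 ∧ ∀ z : ℂ, ‖f z‖ ≤ A' * Real.exp (B' * ‖z‖ ^ ρ)) →
    0 < s → C * s ≤ hmax → C * hmax ≤ R → 0 ≤ Hs → (∀ w : ℂ, f w = 0 → |w.im| ≤ Hs) → C * Hs ≤ R →
    (∃ w₀ : ℂ, f w₀ = 0 ∧ w₀.im ≠ 0 ∧ w₀.re = x₀ ∧ |w₀.im| ≤ hmax) →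
    ColumnBudgetMult B f x₀ s R →
    0 ≤ η → C * η ≤ 1 → RemainderBox η f x₀ s hmax R →
    EventConcl A f x₀ s hmax R B

/-- `TiltedLandingEvent3` — seam of the TiltedLandingLaw421 descent framework, part 01 (token-identical port of `Cruxes/TiltedLandingLaw421/Lines/law421birthS.lean`; no new mathematics). -/
def TiltedLandingEvent3 : Prop :=
  ∃ A C : ℝ, 0 < A ∧ 0 < C ∧ ∀ (η : ℝ) (f : ℂ → ℂ) (x₀ s hmax R Hs : ℝ) (B : ℕ), TiltedLandingEventAt3 A C η f x₀ s hmax R Hs B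

/-- `XiEventFeed3` — seam of the TiltedLandingLaw421 descent framework, part 01 (token-identical port of `Cruxes/TiltedLandingLaw421/Lines/law421birthS.lean`; no new mathematics). -/
def XiEventFeed3 (Band : ℝ → ℝ → Prop) (K : ℝ → ℕ) (T₀ T₁ : ℝ) : Prop :=
  ∀ A C : ℝ, 0 < A → 0 < C → ∀ γ δ : ℝ, T₁ < γ → OffLineZeroAt γ δ → Band γ δ →
    ∃ (η s hmax R Hs : ℝ) (B : ℕ),
      (TiltedLandingEventAt3 A C η riemannXiUpper γ s hmax R Hs B → EventConcl A riemannXiUpper γ s hmax R B) ∧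
      (∀ (k : ℕ) (x : ℝ), (k : ℝ) ≤ A * hmax / s + B + 1 → |x - γ| < R / 2 + Real.sqrt k * hmax → T₀ < x ∧ k ≤ K x)

/-- `landingLawOnBand_of_event3` — seam of the TiltedLandingLaw421 descent framework, part 01 (token-identical port of `Cruxes/TiltedLandingLaw421/Lines/law421birthS.lean`; no new mathematics). -/
theorem landingLawOnBand_of_event3 {Band : ℝ → ℝ → Prop} {K : ℝ → ℕ} {T₀ T₁ : ℝ}
    (hE : TiltedLandingEvent3) (hfeed : XiEventFeed3 Band K T₀ T₁) : LandingLawOnBand xiNLEvent K T₀ T₁ Band := by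
  obtain ⟨A, C, hA, hC, H⟩ := hE
  intro γ δ hγ hz hband
  obtain ⟨η, s, hmax, R, Hs, B, hmet, hbk⟩ := hfeed A C hA hC γ δ hγ hz hband
  obtain ⟨k, hk, x, hx, hev⟩ := hmet (H η riemannXiUpper γ s hmax R Hs B)
  exact ⟨x, (hbk k x hk hx).1, k, (hbk k x hk hx).2, (nlEventOf_xi_iff k x).1 hev⟩

/-- `TiltedLandingEventAt4` — seam of the TiltedLandingLaw421 descent framework, part 01 (token-identical port of `Cruxes/TiltedLandingLaw421/Lines/law421birthS.lean`; no new mathematics). -/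
def TiltedLandingEventAt4 (A C η : ℝ) (f : ℂ → ℂ) (x₀ s hmax R Hs : ℝ) (B : ℕ) : Prop :=
  Differentiable ℂ f → (∀ x : ℝ, (f (x : ℂ)).im = 0) →
    (∃ A' B' ρ : ℝ, ρ < 2 ∧ ∀ z : ℂ, ‖f z‖ ≤ A' * Real.exp (B' * ‖z‖ ^ ρ)) →
    0 < s → C * s ≤ hmax → C * hmax ≤ R → 0 ≤ Hs → (∀ w : ℂ, f w = 0 → |w.im| ≤ Hs) → C * Hs ≤ R →
    (∃ w₀ : ℂ, f w₀ = 0 ∧ w₀.im ≠ 0 ∧ w₀.re = x₀ ∧ |w₀.im| ≤ hmax) →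
    ColumnBudgetMult B f x₀ s R → HalfSlabBudget B f x₀ s R →
    0 ≤ η → C * η ≤ 1 → RemainderBox η f x₀ s hmax R →
    EventConcl A f x₀ s hmax R B

/-- `TiltedLandingEvent4` — seam of the TiltedLandingLaw421 descent framework, part 01 (token-identical port of `Cruxes/TiltedLandingLaw421/Lines/law421birthS.lean`; no new mathematics). -/
def TiltedLandingEvent4 : Prop :=
  ∃ A C : ℝ, 0 < A ∧ 0 < C ∧ ∀ (η : ℝ) (f : ℂ → ℂ) (x₀ s hmax R Hs : ℝ) (B : ℕ), TiltedLandingEventAt4 A C η f x₀ s hmax R Hs B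

/-- `tiltedLandingEvent4_of_event3` — seam of the TiltedLandingLaw421 descent framework, part 01 (token-identical port of `Cruxes/TiltedLandingLaw421/Lines/law421birthS.lean`; no new mathematics). -/
theorem tiltedLandingEvent4_of_event3 (h : TiltedLandingEvent3) : TiltedLandingEvent4 := by
  obtain ⟨A, C, hA, hC, H⟩ := h
  exact ⟨A, C, hA, hC, fun η f x₀ s hmax R Hs B hd hr ho hs h1 h2 h3 h4 h5 h6 hB _ hη hCη hRB ↦
    H η f x₀ s hmax R Hs B hd hr ho hs h1 h2 h3 h4 h5 h6 hB hη hCη hRB⟩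

/-- `ThinBandLaw` — seam of the TiltedLandingLaw421 descent framework, part 01 (token-identical port of `Cruxes/TiltedLandingLaw421/Lines/law421birthS.lean`; no new mathematics). -/
def ThinBandLaw (Ethin : ℕ → ℝ → Prop) (K : ℝ → ℕ) (T₀ T₁ cthin : ℝ) : Prop :=
  LandingLawOnBand Ethin K T₀ T₁ (thinBandL (thinEdge cthin))

/-- `LowPairLaw` — seam of the TiltedLandingLaw421 descent framework, part 01 (token-identical port of `Cruxes/TiltedLandingLaw421/Lines/law421birthS.lean`; no new mathematics). -/
def LowPairLaw (K : ℝ → ℕ) (T₀ T₁ cthin c : ℝ) : Prop :=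
  LandingLawOnBand xiNLEventLow K T₀ T₁ (lowBandL (thinEdge cthin) (thickEdge c))

/-- `xiSpacing` — seam of the TiltedLandingLaw421 descent framework, part 01 (token-identical port of `Cruxes/TiltedLandingLaw421/Lines/law421birthS.lean`; no new mathematics). -/
def xiSpacing (γ : ℝ) : ℝ := 2 * Real.pi / Real.log (γ / (2 * Real.pi))

/-- `SeamRemainder0Xi` — seam of the TiltedLandingLaw421 descent framework, part 01 (renamed from `Remainder0Xi` to avoid registry conflict with stmt-RiemannHypothesis-24730; token-identical body). -/
def SeamRemainder0Xi (η : ℝ) (R : ℝ → ℝ) (T₁ : ℝ) : Prop :=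
  ∀ γ : ℝ, T₁ < γ → RemainderBox η riemannXiUpper γ (xiSpacing γ) (1 / 2) (R γ)

/-- `XiColumnBudget` — seam of the TiltedLandingLaw421 descent framework, part 01 (token-identical port of `Cruxes/TiltedLandingLaw421/Lines/law421birthS.lean`; no new mathematics). -/
def XiColumnBudget (B : ℕ) (R : ℝ → ℝ) (T₁ : ℝ) : Prop :=
  ∀ γ : ℝ, T₁ < γ → ColumnBudgetMult B riemannXiUpper γ (xiSpacing γ) (R γ)

/-- `bandLaw_of_rh` — seam of the TiltedLandingLaw421 descent framework, part 01 (token-identical port of `Cruxes/TiltedLandingLaw421/Lines/law421birthS.lean`; no new mathematics). -/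
theorem bandLaw_of_rh (hRH : RiemannHypothesis) (E : ℕ → ℝ → Prop) (K : ℝ → ℕ) (T₀ T₁ : ℝ) (P : ℝ → ℝ → Prop) :
    LandingLawOnBand E K T₀ T₁ P :=
  fun γ δ _ hz _ ↦ absurd hz (seenClean_of_rh hRH Set.univ γ δ (Set.mem_univ _))

/-- `thinBandLaw_of_rh` — seam of the TiltedLandingLaw421 descent framework, part 01 (token-identical port of `Cruxes/TiltedLandingLaw421/Lines/law421birthS.lean`; no new mathematics). -/
theorem thinBandLaw_of_rh (hRH : RiemannHypothesis) (Ethin : ℕ → ℝ → Prop) (K : ℝ → ℕ) (T₀ T₁ cthin : ℝ) :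
    ThinBandLaw Ethin K T₀ T₁ cthin := bandLaw_of_rh hRH _ K T₀ T₁ _

/-- `lowPairLaw_of_rh` — seam of the TiltedLandingLaw421 descent framework, part 01 (token-identical port of `Cruxes/TiltedLandingLaw421/Lines/law421birthS.lean`; no new mathematics). -/
theorem lowPairLaw_of_rh (hRH : RiemannHypothesis) (K : ℝ → ℕ) (T₀ T₁ cthin c : ℝ) : LowPairLaw K T₀ T₁ cthin c :=
  bandLaw_of_rh hRH _ K T₀ T₁ _

namespace Annex

end Annex
end RhIdea6.G17.W07C7
end
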